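import Summits.ABC.IUTFork.Cor312BridgeHypsDHVolHullSets
import Summits.ABC.IUTFork.Cor312StatementBridges
import HarnessLib

/-!
# [IUTchIII] Corollary 3.12, statement — NON-VACUITY AT THE GENUINE REAL CONTAINER: an inhabited `Cor312.Setting`
# over `Real.situationDHVol` satisfying `BridgeHyps`, `ThetaRegionsAdm`, `GlobalVolumeTransport` AND `Statement`

Record-only file (D-0012) of the abc-iut cell (Cor. 3.12 sub-crew, seat abc-iut-c312-5, gen 3; D-0067 TEAM A row
A-0, vacuity audit in the discipline of LANA Rem. 8.2.1 / plan ADJUDICATION-SPEC §1 «at a non-toy setting»);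
TAKES NO SIDE. The cell's hypothesis-structures for the disputed step — c312-6's `BridgeHyps`, c312-11's
`ThetaRegionsAdm` and `GlobalVolumeTransport` (the TEAM B gap input), and the typed conclusion `Setting.Statement`
of [IUTchIII] Cor. 3.12 (kurims `paper:url-4b091feeb646` p. 174 l. 16–18) — have so far been shown jointly
satisfiable only on TOY situations (`Cor312StatementBridges.toySetting`, `Cor312LogKummerRoute2Checks`). THIS
file exhibits a setting over the GENUINE real container — c312-5's `Real.situationDHVol` (the real
Dupuy–Hilado-level log-shells of the number field `F` with the VERBATIM admissible regions and log-volume of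
[IUTchIII] Rmk. 3.1.1 (ii)(iii)) — on which ALL FOUR hold:

* context data: the one-point output of Prop. 3.7 / splitting monoids / `q`-pilot data (`unitSigDH`,
  `unitSplitDH`, `unitQDataDH`, as in c312-7's toy) and the lattice `^{n,m}𝓗𝓣 := (n, m)` (`unitLatticeDH`);
* pilot regions: the UNIT boxes — Θ-boxes and `q`-centre both the trivial line bundle `𝒪_L` at every packet
  (`Real.settingDHVolUnit`; `hq` trivial, `hfin` PROVED: the `q`-hull-set `e⁻¹(𝒪_L) = e⁻¹(Π (R)^∼)` has log-volume
  `0` at every place, `hfin_unitCentre`);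
* THEOREMS: `bridgeHyps_settingDHVolUnit` (c312-5 `bridgeHyps_settingDHVol_unitBoxes`), `thetaRegionsAdm_…`
  (c312-6 `thetaRegionsAdm_settingDHVol_of_isHullSet`), `globalVolumeTransport_settingDHVolUnit` (at position
  `m = 0` the Θ- and `q`-regions COINCIDE, so the volume comparison is an equality), `statement_settingDHVolUnit`
  (c312-6's route), packaged as `exists_settingDHVol_bridgeHyps_statement`.
HONEST SCOPE: this witnesses CONSISTENCY of the typed interfaces at the real container, nothing more — the unit
boxes are NOT the Θ-pilot object of [IUTchIII] Def. 3.8 (i) (whose `q`-pilot has `−|log(q)| < 0`; here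
`−|log(q)| = −|log(Θ)| = 0`), and no reading of Step (xi) is involved. [claim: Mochizuki2012, status: disputed]
for the quoted names; everything proved is bookkeeping. Deliberately NOT here: the Dupuy–Hilado boxes
(abc-iut-c312-3 `Cor312PilotIdelesDH`), any judgement.
-/

noncomputable section

open Set Function NumberField IsDedekindDomain Bornology
open scoped Pointwise

namespace Summit.ABC

namespace IUTFork

namespace Thm311

namespace Real

open Cor312 Cor312Vol Literature.IUT.LogThetaLattice Literature.IUT.LogVolume

variable {F : Type} [Field F] [NumberField F] (X : PilotData F) {logv : PadicLogs F} (hlog : LogvAnalytic logv)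

/-! ## 1. One-point context data over c312-5's index `thetaIndex X` -/

/-- A one-point output of [IUTchIII] Prop. 3.7 over the index data of `X` (every Frobenioid, strip and object a
point; as c312-7's `Cor312.Checks.toySig`). Context data for a witness only. [folklore] -/
def unitSigDH : GlobalLGPFrobenioidSignature (thetaIndex X).lstar (thetaIndex X).V (· ∈ (thetaIndex X).Vbad)
    Unit (fun _ _ => Unit) (fun _ => Unit) id Unit (fun _ _ => Unit) (fun _ _ => Unit) where
  FMOD := fun _ => ()
  Fmod := fun _ => ()
  Ffrak := fun _ => ()
  isoModMOD := fun _ => ()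
  isoModFrak := fun _ => ()
  isoFrakMOD := fun _ => ()
  CLGP := ()
  Clgp := ()
  FLGP := ()
  Flgp := ()
  Fgau := ()
  isoGauLGP := ()
  isoLGPlgp := ()
  isoCLGPlgp := ()
  embLGP := fun _ _ => ()
  embLgp := fun _ _ => ()
  embLGP_injective := fun a b _ => Subsingleton.elim a b
  embLgp_injective := fun a b _ => Subsingleton.elim a b
  objOfLgp := fun _ => ()
  objOfLGP := fun _ => ()
  objOfFrak := fun _ _ => ()
  objOfMOD := fun _ _ => ()

/-- One-point splitting monoids over the bad places of `X`. [folklore] -/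
def unitSplitDH : SplittingMonoids (fun (v : (thetaIndex X).V) (_ : v ∈ (thetaIndex X).Vbad) => Unit) where
  Msplit := fun _ _ => ⊤
  exists_gen := fun _ _ => ⟨⟨(), trivial⟩, Cor312.Checks.top_unit_isGenerator _⟩

/-- One-point `q`-pilot data over the bad places of `X`. [folklore] -/
def unitQDataDH : QPilotData Unit (fun (v : (thetaIndex X).V) (_ : v ∈ (thetaIndex X).Vbad) => Unit) where
  q := fun _ _ => ()
  q_gen := fun _ _ => Cor312.Checks.unit_isGenerator _
  objOf := fun _ => ()

/-- The lattice `^{n,m}𝓗𝓣 := (n, m)` with trivial full log-links (as in c312-7's toy). [folklore] -/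
def unitLatticeDH : LGPGaussianLogThetaLattice (HT := ℤ × ℤ) (LogLink := fun _ _ => Unit) (fun _ => True) where
  theater := fun n m => (n, m)
  distinct := fun p q h => by simpa using h
  logLink := fun _ _ => ()
  logLink_full := fun _ _ => trivial

/-! ## 2. The unit setting over the genuine real container -/

section Witness

variable (M : Type) [Field M] [NumberField M]
  (archPk : ∀ (j : (thetaIndex X).Label) (vQ : (thetaIndex X).VQ), Set ((logShellsDH X logv).Packet j vQ))
  (archSub : ∀ (j : (thetaIndex X).Label) (v : (thetaIndex X).V),
    Set ((logShellsDH X logv).Packet j ((thetaIndex X).over v)))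
  (Ψ : ℤ → ∀ v : (thetaIndex X).V, v ∈ (thetaIndex X).Vbad → Set ((logShellsDH X logv).StarPacket v))
  (act : ℤ → ∀ v : (thetaIndex X).V, v ∈ (thetaIndex X).Vbad →
    (logShellsDH X logv).StarPacket v → Module.End ℚ ((logShellsDH X logv).StarPacket v))
  (Mmod : ℤ → ∀ j : (thetaIndex X).LabelStar, Set ((logShellsDH X logv).GlobalPacket j.1))
  (region : ℤ → ∀ j : (thetaIndex X).LabelStar, FinDivisor M → ∀ vQ : (thetaIndex X).VQ,
    Set ((logShellsDH X logv).Packet j.1 vQ))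
  (n : ℤ)

/-- **`hfin` for the unit `q`-centre, PROVED**: the `q`-hull-set `e⁻¹(𝒪_L)` has log-volume `0` at EVERY place
(at `p`: `= e⁻¹(Π (R_{v⃗})^∼)`, Dupuy–Hilado normalisation; at `∞`: trivial container), so its volume has empty,
hence finite, support. [folklore] -/
theorem hfin_unitCentre (j : (thetaIndex X).Label) :
    (Function.support fun vQ : (thetaIndex X).VQ =>
      ((situationDHVol X hlog M archPk archSub Ψ act Mmod region).D n).logvol j vQ
        (factorMapDH X hlog j vQ ⁻¹' hullSet (factorFieldDH X hlog j vQ) (fun _ => 1))).Finite := by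
  refine Set.finite_empty.subset fun vQ hvQ => ?_
  rcases vQ with u | pp
  · exact hvQ (logvol_settingDHVol_inl X hlog M archPk archSub Ψ act Mmod region n j u _)
  · exact hvQ ((congrArg (((situationDHVol X hlog M archPk archSub Ψ act Mmod region).D n).logvol j (.inr pp))
      (preimage_factorMapDH_hullSet_one X hlog j pp)).trans
      (logvol_preimage_normalizedPacket_settingDHVol X hlog M archPk archSub Ψ act Mmod region n j pp))

/-- **The UNIT SETTING over the genuine real container**: c312-5's `Real.settingDHVol` at column `n` with the
one-point context data, Θ-boxes `𝒪_L` at every `(m, j, v_ℚ)` and `q`-centre `1` (so the `q`-region is `e⁻¹(𝒪_L)`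
too); `hq` trivial, `hadm`/`hfin` proved. A witness, not a model of [IUTchIII] Def. 3.8 (i). [folklore] -/
def settingDHVolUnit : Cor312.Setting (situationDHVol X hlog M archPk archSub Ψ act Mmod region) :=
  settingDHVol X hlog M archPk archSub Ψ act Mmod region n unitLatticeDH (unitSigDH X) (unitSplitDH X)
    (unitQDataDH X) (fun (_ : ℤ) (_ : Unit) (j : (thetaIndex X).Label) (vQ : (thetaIndex X).VQ) =>
      hullSet (factorFieldDH X hlog j vQ) (fun _ => 1))
    (fun (_ : Unit) (_ : (thetaIndex X).Label) (_ : (thetaIndex X).VQ) => fun _ => 1)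
    (fun _ _ _ => one_ne_zero) (hfin_unitCentre X hlog M archPk archSub Ψ act Mmod region n)

/-- The column of the unit setting. [folklore] -/
theorem settingDHVolUnit_n : (settingDHVolUnit X hlog M archPk archSub Ψ act Mmod region n).n = n := rfl

/-- The `m`-th Θ-region of the unit setting is `e⁻¹(𝒪_L)`. [folklore] -/
theorem settingDHVolUnit_thetaRegion (m : ℤ) (j : (thetaIndex X).Label) (vQ : (thetaIndex X).VQ) :
    (settingDHVolUnit X hlog M archPk archSub Ψ act Mmod region n).thetaRegion m j vQ =
      factorMapDH X hlog j vQ ⁻¹' hullSet (factorFieldDH X hlog j vQ) (fun _ => 1) := rfl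

/-- The `q`-region of the unit setting is `e⁻¹(𝒪_L)`. [folklore] -/
theorem settingDHVolUnit_qRegion (j : (thetaIndex X).Label) (vQ : (thetaIndex X).VQ) :
    (settingDHVolUnit X hlog M archPk archSub Ψ act Mmod region n).qRegion j vQ =
      factorMapDH X hlog j vQ ⁻¹' hullSet (factorFieldDH X hlog j vQ) (fun _ => 1) := rfl

/-- `BridgeHyps` holds for the unit setting (c312-5 `bridgeHyps_settingDHVol_unitBoxes`). [folklore] -/
theorem bridgeHyps_settingDHVolUnit :
    BridgeHyps (settingDHVolUnit X hlog M archPk archSub Ψ act Mmod region n) :=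
  bridgeHyps_settingDHVol_unitBoxes X hlog M archPk archSub Ψ act Mmod region n unitLatticeDH (unitSigDH X) (unitSplitDH X)
    (unitQDataDH X) (fun (_ : Unit) (_ : (thetaIndex X).Label) (_ : (thetaIndex X).VQ) => fun _ => 1)
    (fun _ _ _ => one_ne_zero) (hfin_unitCentre X hlog M archPk archSub Ψ act Mmod region n)

/-- `ThetaRegionsAdm` holds for the unit setting (every box is the hull-set `𝒪_L`; abc-iut-c312-6's
`thetaRegionsAdm_settingDHVol_of_isHullSet`). [folklore] -/
theorem thetaRegionsAdm_settingDHVolUnit :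
    ThetaRegionsAdm (settingDHVolUnit X hlog M archPk archSub Ψ act Mmod region n) :=
  thetaRegionsAdm_settingDHVol_of_isHullSet X hlog M archPk archSub Ψ act Mmod region n unitLatticeDH (unitSigDH X) (unitSplitDH X)
    (unitQDataDH X) (fun (_ : ℤ) (_ : Unit) (j : (thetaIndex X).Label) (vQ : (thetaIndex X).VQ) =>
      hullSet (factorFieldDH X hlog j vQ) (fun _ => 1))
    (fun (_ : Unit) (_ : (thetaIndex X).Label) (_ : (thetaIndex X).VQ) => fun _ => 1)
    (fun _ _ _ => one_ne_zero) (hfin_unitCentre X hlog M archPk archSub Ψ act Mmod region n)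
    fun _ _ _ => ⟨fun _ => 1, fun _ => one_ne_zero, rfl⟩

/-- **`GlobalVolumeTransport` holds for the unit setting**, at the single position `m = 0`: there the `m`-th
Kummer image of the Θ-pilot and the `q`-pilot image are THE SAME region `e⁻¹(𝒪_L)` at every packet, so
c312-11's volume comparison is an equality (and the support condition is `hfin_unitCentre`). [folklore] -/
theorem globalVolumeTransport_settingDHVolUnit :
    GlobalVolumeTransport (settingDHVolUnit X hlog M archPk archSub Ψ act Mmod region n) := by
  refine globalVolumeTransport_of_at (m₀ := 0) ⟨fun i => ?_, le_of_eq ?_⟩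
  · simp only [settingDHVolUnit_thetaRegion, settingDHVolUnit_n]
    exact hfin_unitCentre X hlog M archPk archSub Ψ act Mmod region n (Setting.labelSucc i)
  · simp only [Setting.negLogQ, Setting.qLocal, settingDHVolUnit_thetaRegion, settingDHVolUnit_qRegion,
      settingDHVolUnit_n]

/-- `ThetaFinite` holds for the unit setting (c312-5 `thetaFinite_settingDHVol`: unit boxes are bounded,
nondegenerate and `= 𝒪_L` everywhere). [folklore] -/
theorem thetaFinite_settingDHVolUnit :
    (settingDHVolUnit X hlog M archPk archSub Ψ act Mmod region n).ThetaFinite :=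
  (bridgeHyps_settingDHVolUnit X hlog M archPk archSub Ψ act Mmod region n).finite

/-- **The typed `Statement` of Cor. 3.12 HOLDS for the unit setting** (abc-iut-c312-6's route
`statement_settingDHVol_of_globalVolumeTransport`; here `−|log(Θ)| ∈ ℝ` and `−|log(Θ)| ≥ −|log(q)|` with both
sides built from the SAME regions). A consistency witness only. [folklore] -/
theorem statement_settingDHVolUnit :
    (settingDHVolUnit X hlog M archPk archSub Ψ act Mmod region n).Statement :=
  statement_settingDHVol_of_globalVolumeTransport X hlog M archPk archSub Ψ act Mmod region n unitLatticeDH (unitSigDH X) (unitSplitDH X)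
    (unitQDataDH X) (fun (_ : ℤ) (_ : Unit) (j : (thetaIndex X).Label) (vQ : (thetaIndex X).VQ) =>
      hullSet (factorFieldDH X hlog j vQ) (fun _ => 1))
    (fun (_ : Unit) (_ : (thetaIndex X).Label) (_ : (thetaIndex X).VQ) => fun _ => 1)
    (fun _ _ _ => one_ne_zero) (hfin_unitCentre X hlog M archPk archSub Ψ act Mmod region n)
    (fun _ _ _ => ⟨fun _ => 1, fun _ => one_ne_zero, rfl⟩)
    (thetaFinite_settingDHVolUnit X hlog M archPk archSub Ψ act Mmod region n)
    (globalVolumeTransport_settingDHVolUnit X hlog M archPk archSub Ψ act Mmod region n)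

/-- **NON-VACUITY AT THE GENUINE REAL CONTAINER**: over c312-5's `Real.situationDHVol` (real log-shells of `F`,
verbatim container) there EXISTS a `Cor312.Setting` on which c312-6's `BridgeHyps`, c312-11's `ThetaRegionsAdm` and
`GlobalVolumeTransport`, and the typed `Statement` of [IUTchIII] Cor. 3.12 ALL hold — the hypothesis-structures
of the A/B lines are jointly satisfiable off the toys (LANA Rem. 8.2.1 discipline). [folklore] -/
theorem exists_settingDHVol_bridgeHyps_statement :
    ∃ P : Cor312.Setting (situationDHVol X hlog M archPk archSub Ψ act Mmod region),
      BridgeHyps P ∧ ThetaRegionsAdm P ∧ GlobalVolumeTransport P ∧ P.Statement :=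
  ⟨settingDHVolUnit X hlog M archPk archSub Ψ act Mmod region 0,
    bridgeHyps_settingDHVolUnit X hlog M archPk archSub Ψ act Mmod region 0,
    thetaRegionsAdm_settingDHVolUnit X hlog M archPk archSub Ψ act Mmod region 0,
    globalVolumeTransport_settingDHVolUnit X hlog M archPk archSub Ψ act Mmod region 0,
    statement_settingDHVolUnit X hlog M archPk archSub Ψ act Mmod region 0⟩

end Witness

end Real

end Thm311

end IUTFork

end Summit.ABC

end
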